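import Mathlib

/-!
# `WeightedInvariant.LocalWeightedDrop`, line `vertex-descent-weight-residues`: slice-then-cylinder

Route `ResolutionOfSingularities/WeightedInvariant`, crux `LocalWeightedDrop`
(stmt-ResolutionOfSingularities-8899), stub `stub_sliceCyl` of the lead's skeleton
`work/LocalWeightedDrop.lean`, PROVED here (statement verbatim from the ledger registration).

**Statement (SLICE-THEN-CYLINDER).** A successor germ `g` lives in
`k[[s, y₁, …, yₙ]] = MvPowerSeries (Fin (n+1)) k` (`s = X 0`, `yᵢ = X i.succ`).  At a coordinate
`i : Fin n` the flat slice `g|_{yᵢ = 0}` is the `n`-variable series obtained by the substitution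
`X i.succ ↦ 0`, `X j ↦ X (Fin.predAbove i j)` (renumbering `Fin (n+1) ∖ {i.succ}` to `Fin n`), and the
cylinder along `yᵢ` of an `n`-variable series is the substitution `X m ↦ X (i.succ.succAbove m)`.
The cylinder over the flat slice of `g` is the substitution killing `yᵢ` in `g`
(`X i.succ ↦ 0`, `X j ↦ X j` otherwise).

**Proof.** Both substitution families have zero constant coefficients, hence satisfy
`MvPowerSeries.HasSubst`; compose them with `MvPowerSeries.subst_comp_subst_apply` and compare the
composite family with the killing family index by index: at `j = i.succ` both are `0`
(a substitution `AlgHom` maps `0` to `0`), and at `j ≠ i.succ` the composite is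
`X (i.succ.succAbove (i.predAbove j)) = X j` by `Fin.succ_succAbove_predAbove`.
-/

set_option linter.dupNamespace false -- mandated namespace of this single-conjunct summit

namespace Summit.ResolutionOfSingularities.ResolutionOfSingularities.Theorems

/-- SLICE-THEN-CYLINDER, stub `stub_sliceCyl` of the line `vertex-descent-weight-residues` of crux
`LocalWeightedDrop` (stmt-ResolutionOfSingularities-8899).  For `g : k[[s, y₁, …, yₙ]]` and a
coordinate `i : Fin n`, re-embedding the `n`-variable flat slice `g|_{yᵢ = 0}`
(`X i.succ ↦ 0`, `X j ↦ X (i.predAbove j)`) as a cylinder along `yᵢ` (`X m ↦ X (i.succ.succAbove m)`)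
is the substitution killing `yᵢ` in `g` (`X i.succ ↦ 0`, `X j ↦ X j` otherwise). -/
theorem stub_sliceCyl : ∀ (k : Type) [Field k] (n : ℕ) (i : Fin n) (g : MvPowerSeries (Fin (n + 1)) k),
    MvPowerSeries.subst (fun m : Fin n => (MvPowerSeries.X ((Fin.succ i).succAbove m) : MvPowerSeries (Fin (n + 1)) k))
      (MvPowerSeries.subst (fun j : Fin (n + 1) => if j = i.succ then (0 : MvPowerSeries (Fin n) k)
        else MvPowerSeries.X (Fin.predAbove i j)) g) =
    MvPowerSeries.subst (fun j : Fin (n + 1) => if j = i.succ then (0 : MvPowerSeries (Fin (n + 1)) k)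
      else MvPowerSeries.X j) g := by
  intro k _ n i g
  -- the slicing family `X i.succ ↦ 0`, `X j ↦ X (i.predAbove j)` is substitutable
  have ha : MvPowerSeries.HasSubst (fun j : Fin (n + 1) =>
      if j = i.succ then (0 : MvPowerSeries (Fin n) k) else MvPowerSeries.X (Fin.predAbove i j)) :=
    MvPowerSeries.hasSubst_of_constantCoeff_zero fun j => by
      split_ifs <;> simp
  -- the cylinder family `X m ↦ X (i.succ.succAbove m)` is substitutable
  have hb : MvPowerSeries.HasSubst (fun m : Fin n =>
      (MvPowerSeries.X ((Fin.succ i).succAbove m) : MvPowerSeries (Fin (n + 1)) k)) :=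
    MvPowerSeries.hasSubst_of_constantCoeff_zero fun m => by simp
  -- compose the two substitutions and compare the families index by index
  rw [MvPowerSeries.subst_comp_subst_apply ha hb]
  congr 1
  funext j
  split_ifs with hj
  · rw [← MvPowerSeries.coe_substAlgHom hb]
    exact map_zero _
  · rw [MvPowerSeries.subst_X hb, Fin.succ_succAbove_predAbove hj]

end Summit.ResolutionOfSingularities.ResolutionOfSingularities.Theorems
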